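import Literature.AnabelianGeometry.SemiGraphs.ProfiniteSemiGraphIsoTransportApproximators
import Literature.AnabelianGeometry.SemiGraphs.CoveringGraphGaloisCountable
import HarnessLib

/-!
# The hypotheses of [SemiAnbd] Prop 3.6 / Thm 3.7 / Cor 3.9 and strict coherence descend along
# isomorphisms of profinite presentations (route T, TRANSPORT III: assembly)

Mochizuki, *Semi-graphs of anabelioids*, Publ. RIMS **42** (2006), §2 Def. 2.3–2.4 pp. 24–26, §3
Prop. 3.6 / Thm. 3.7 / Cor. 3.9 pp. 38–42, Def. 3.5 (i) p. 37 [cite: MochizukiSemiAnbd2006, Prop 3.6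
p.38]; strict coherence and Galois-countability from [IUTchI] Rmk. 2.5.3 (i) (T2)–(T4) p. 53
[cite: Mochizuki2012, IUTchI Rem. 2.5.3(i)(T4) p.53].  For `F : X → Y` with `IsIso F.base` and
bijective constituent homomorphisms (abc-iut-L3-t3's `Hom.IsoOver` with the base forgotten):

* `isStrictlyCoherent_of_iso` — (T3) descends (dense generating finsets transport along `≃ₜ*`,
  quasi-coherence by TRANSPORT II);
* `prop36Hypotheses_of_iso` / `thm37Hypotheses_of_iso` / `cor39Hypotheses_of_iso` — the ASSEMBLY over
  TRANSPORT I–II; the (T2) field is re-derived from strict coherence by (T4)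
  (`isGaloisCountable_of_isStrictlyCoherent`) rather than transported object-wise, so the statements
  carry `Y.IsStrictlyCoherent`;
* `Hom.IsoOver.thm37Hypotheses_and_isStrictlyCoherent` — the same from an isomorphism OVER a base;
* `thm37Hypotheses_of_isoOver_coveringHom` — with route T (`CoveringGraphGaloisCountable`): a
  presentation isomorphic over `G` to the covering semi-graph `G_S` of a connected tempered covering of a
  connected strictly coherent Thm-3.7 graph `G` is again a strictly coherent Thm-3.7 graph (the input
  of abc-iut-L3-t3's tempered `SgA`-arrows `IsTemperedCoveringOf`).

Proof-only (abc-iut cell, L3 route T · TRANSPORT; seat abc-iut-L3-d6); no definition; nothing here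
bears on [IUTchIII] Cor. 3.12.
-/

open CategoryTheory Topology

namespace Literature.AnabelianGeometry.SemiGraphs

namespace ProfiniteSemiGraph

open Literature.AlgebraicGeometry.Frobenioids (IsConnectedObj)

universe u

variable {X Y : ProfiniteSemiGraph.{u}} (F : Hom X Y)

/-! ### Strict coherence descends -/

/-- A dense finite generating set transports along an isomorphism of topological groups, keeping its
size. [cite: Mochizuki2012, IUTchI Rem. 2.5.3(i)(T3) p.53] -/
private theorem exists_denseGenerators_of_continuousMulEquiv' {G H : Type u} [Group G]
    [TopologicalSpace G] [IsTopologicalGroup G] [Group H] [TopologicalSpace H] [IsTopologicalGroup H]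
    (e : G ≃ₜ* H) {N : ℕ} (s : Finset G) (hs : s.card ≤ N)
    (hd : (Subgroup.closure (s : Set G)).topologicalClosure = ⊤) :
    ∃ t : Finset H, t.card ≤ N ∧ (Subgroup.closure (t : Set H)).topologicalClosure = ⊤ := by
  classical
  refine ⟨s.image e, Finset.card_image_le.trans hs, ?_⟩
  rw [Finset.coe_image]
  change (Subgroup.closure (e.toMulEquiv.toMonoidHom '' (s : Set G))).topologicalClosure = ⊤
  rw [← MonoidHom.map_closure]
  exact DenseRange.topologicalClosure_map_subgroup (f := e.toMulEquiv.toMonoidHom)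
    (map_continuous e) e.surjective.denseRange hd

section Iso

variable [IsIso (C := SemiGraph.{u}) F.base]

/-- **Strict coherence ([IUTchI] Rmk. 2.5.3 (i) (T3)) descends along an isomorphism of presentations.**
[cite: Mochizuki2012, IUTchI Rem. 2.5.3(i)(T3) p.53] -/
theorem isStrictlyCoherent_of_iso (hlt : F.IsLocallyTrivial) (hY : Y.IsStrictlyCoherent) :
    X.IsStrictlyCoherent := by
  classical
  obtain ⟨N, hN1, hgenV, hgenE⟩ := hY.exists_bound
  have hV : ∀ v : X.graph.Vertex, ∃ t : Finset (X.Gv v), t.card ≤ N ∧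
      (Subgroup.closure (t : Set (X.Gv v))).topologicalClosure = ⊤ := fun v => by
    obtain ⟨e, -⟩ := exists_continuousMulEquiv_of_bijective (F.hV v) (hlt.1 v)
    obtain ⟨s, hs, hgen⟩ := hgenV (F.base.vertexMap v)
    exact exists_denseGenerators_of_continuousMulEquiv' e.symm s hs hgen
  have hE : ∀ e : X.graph.Edge, ∃ t : Finset (X.Ge e), t.card ≤ N ∧
      (Subgroup.closure (t : Set (X.Ge e))).topologicalClosure = ⊤ := fun e' => by
    obtain ⟨e, -⟩ := exists_continuousMulEquiv_of_bijective (F.hE e') (hlt.2 e')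
    obtain ⟨s, hs, hgen⟩ := hgenE (F.base.edgeMap e')
    exact exists_denseGenerators_of_continuousMulEquiv' e.symm s hs hgen
  exact ⟨⟨isQuasiCoherent_of_iso F hlt hY.isCoherent.1, fun v => (hV v).imp fun t ht => ht.2,
    fun e => (hE e).imp fun t ht => ht.2⟩, ⟨N, hN1, hV, hE⟩⟩

/-- Coherence descends (with the uniform bound of strict coherence on `Y`).
[cite: MochizukiSemiAnbd2006, Def 2.3(iii) p.25] -/
theorem isCoherent_of_iso (hlt : F.IsLocallyTrivial) (hY : Y.IsStrictlyCoherent) : X.IsCoherent :=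
  (isStrictlyCoherent_of_iso F hlt hY).isCoherent

/-! ### Assembly -/

/-- **The hypotheses of [SemiAnbd] Prop. 3.6 descend along an isomorphism of presentations** (for a
strictly coherent `Y`; the Galois-countability of `X` is re-derived from its strict coherence by
[IUTchI] Rmk. 2.5.3 (i) (T4)). [cite: MochizukiSemiAnbd2006, Prop 3.6 p.38] -/
theorem prop36Hypotheses_of_iso (hlt : F.IsLocallyTrivial) (h36 : Y.Prop36Hypotheses)
    (hsc : Y.IsStrictlyCoherent) : X.Prop36Hypotheses :=
  have hconn : X.IsConnected := SemiGraph.isConnected_of_isIso' F.base h36.isConnected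
  have hv : X.HasVertex := SemiGraph.nonempty_vertex_of_isIso F.base h36.hasVertex
  have hcnt : X.IsCountable := SemiGraph.isCountable_of_isIso F.base h36.isCountable
  have hscX : X.IsStrictlyCoherent := isStrictlyCoherent_of_iso F hlt hsc
  { isConnected := hconn
    isCountable := hcnt
    isGaloisCountable := isGaloisCountable_of_isStrictlyCoherent hconn hv hcnt hscX
    hasVertex := hv
    isOfInjectiveType := isOfInjectiveType_of_iso F hlt h36.isOfInjectiveType
    isQuasiCoherent := hscX.isCoherent.1
    isTotallyElevated := isTotallyElevated_of_iso F hlt h36.isTotallyElevated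
    isTotallyAloof := isTotallyAloof_of_iso hlt h36.isTotallyAloof
    isVerticiallySlim := isVerticiallySlim_of_iso F hlt h36.isVerticiallySlim }

/-- **The hypotheses of [SemiAnbd] Thm. 3.7 descend along an isomorphism of presentations.**
[cite: MochizukiSemiAnbd2006, Thm 3.7 p.40] -/
theorem thm37Hypotheses_of_iso (hlt : F.IsLocallyTrivial) (h37 : Y.Thm37Hypotheses)
    (hsc : Y.IsStrictlyCoherent) : X.Thm37Hypotheses where
  toProp36Hypotheses := prop36Hypotheses_of_iso F hlt h37.toProp36Hypotheses hsc
  isTotallyEstranged := isTotallyEstranged_of_iso hlt h37.isTotallyEstranged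

/-- **The hypotheses of [SemiAnbd] Cor. 3.9 descend along an isomorphism of presentations.**
[cite: MochizukiSemiAnbd2006, Cor 3.9 p.42] -/
theorem cor39Hypotheses_of_iso (hlt : F.IsLocallyTrivial) (h39 : Cor39Hypotheses Y)
    (hsc : Y.IsStrictlyCoherent) : Cor39Hypotheses X where
  toProp36Hypotheses := prop36Hypotheses_of_iso F hlt h39.toProp36Hypotheses hsc
  isTotallyEstranged := isTotallyEstranged_of_iso hlt h39.isTotallyEstranged
  isGraph := SemiGraph.isGraph_of_isIso F.base h39.isGraph

/-- The hereditary class of route T — "hypotheses of Thm. 3.7 and strictly coherent" — descends along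
isomorphisms of presentations. [cite: Mochizuki2012, IUTchI Rem. 2.5.3(i)(T3) p.53] -/
theorem thm37Hypotheses_and_isStrictlyCoherent_of_iso (hlt : F.IsLocallyTrivial)
    (h37 : Y.Thm37Hypotheses) (hsc : Y.IsStrictlyCoherent) :
    X.Thm37Hypotheses ∧ X.IsStrictlyCoherent :=
  ⟨thm37Hypotheses_of_iso F hlt h37 hsc, isStrictlyCoherent_of_iso F hlt hsc⟩

end Iso

/-! ### Along isomorphisms over a base; tempered coverings of strictly coherent Thm-3.7 graphs -/

/-- **Transport along an isomorphism OVER a base** (abc-iut-L3-t3's `Hom.IsoOver p q`, `p : X → P`,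
`q : Y → P`): if `Y` is a strictly coherent Thm-3.7 graph of anabelioids then so is `X`.
[cite: MochizukiSemiAnbd2006, Thm 3.7 p.40] -/
theorem Hom.IsoOver.thm37Hypotheses_and_isStrictlyCoherent {P : ProfiniteSemiGraph.{u}}
    {p : Hom X P} {q : Hom Y P} (I : Hom.IsoOver p q) (h37 : Y.Thm37Hypotheses)
    (hsc : Y.IsStrictlyCoherent) : X.Thm37Hypotheses ∧ X.IsStrictlyCoherent :=
  haveI := I.isIso_base
  thm37Hypotheses_and_isStrictlyCoherent_of_iso I.iso I.isLocallyTrivial h37 hsc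

/-- … and the hypotheses of Cor. 3.9. [cite: MochizukiSemiAnbd2006, Cor 3.9 p.42] -/
theorem Hom.IsoOver.cor39Hypotheses {P : ProfiniteSemiGraph.{u}} {p : Hom X P} {q : Hom Y P}
    (I : Hom.IsoOver p q) (h39 : Cor39Hypotheses Y) (hsc : Y.IsStrictlyCoherent) :
    Cor39Hypotheses X :=
  haveI := I.isIso_base
  cor39Hypotheses_of_iso I.iso I.isLocallyTrivial h39 hsc

/-- **A presentation isomorphic over `G` to the covering semi-graph of anabelioids `G_S` of a connected
tempered covering `S` of a connected, strictly coherent Thm-3.7 graph `G` is a strictly coherent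
Thm-3.7 graph** (route T `thm37Hypotheses_and_isStrictlyCoherent_coveringGraph` + transport) — e.g. the
profinite presentation of the source of a tempered `SgA`-arrow in the sense of abc-iut-L3-t3's
`IsTemperedCoveringOf`. [cite: MochizukiSemiAnbd2006, Thm 3.7 p.40] -/
theorem thm37Hypotheses_of_isoOver_coveringHom {𝒢 : ProfiniteSemiGraph.{u}} (S : CovObj 𝒢)
    {p : Hom X 𝒢} (I : Hom.IsoOver p S.coveringHom) (h37 : 𝒢.Thm37Hypotheses)
    (hsc : 𝒢.IsStrictlyCoherent) (hS : S.IsTempered)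
    (hSc : IsConnectedObj (⟨S, hS⟩ : BTempCat 𝒢)) : X.Thm37Hypotheses ∧ X.IsStrictlyCoherent :=
  have h := S.thm37Hypotheses_and_isStrictlyCoherent_coveringGraph h37 hsc hS hSc
  I.thm37Hypotheses_and_isStrictlyCoherent h.1 h.2

/-- The same over a FINITE coherent Thm-3.7 base graph. [cite: MochizukiSemiAnbd2006, Thm 3.7 p.40] -/
theorem thm37Hypotheses_of_isoOver_coveringHom_of_finite {𝒢 : ProfiniteSemiGraph.{u}}
    [Finite 𝒢.graph.Vertex] [Finite 𝒢.graph.Edge] (S : CovObj 𝒢) {p : Hom X 𝒢}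
    (I : Hom.IsoOver p S.coveringHom) (h37 : 𝒢.Thm37Hypotheses) (hcoh : 𝒢.IsCoherent)
    (hS : S.IsTempered) (hSc : IsConnectedObj (⟨S, hS⟩ : BTempCat 𝒢)) :
    X.Thm37Hypotheses ∧ X.IsStrictlyCoherent :=
  thm37Hypotheses_of_isoOver_coveringHom S I h37 (isStrictlyCoherent_of_finite ⟨‹_›, ‹_›⟩ hcoh) hS hSc

end ProfiniteSemiGraph

end Literature.AnabelianGeometry.SemiGraphs
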